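import Summits.CriticalPhenomena.SAWScalingLimit.Theorems.SurfaceUniversality.Negative.LipApproxIndependenceFalseAux

/-!
# `LipApproxIndependence` is false, II: the two endpoint families at mesh `δ`

Permanent negative knowledge for the crux `SAWCompassLattice.SurfaceUniversality`
(stmt-CriticalPhenomena-6964), continuing `…Negative.LipApproxIndependenceFalseAux` (part I) towards
`…Negative.LipApproxIndependenceFalse` (part III). At mesh `δ ∈ (0, 1/8]` put `n = ⌈1/δ - 1/2⌉₊`
(`nδ`; `1 - δ/2 ≤ nδ < 1 + δ/2`, `n ≥ 8`: the column of centres `(n, ·)`, drawn at abscissa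
`δ(n + 1/2) ∈ [1, 1 + δ)`, is the one just east of the wall `re = 1` of the arch `oct`). Under the
designer rule `rule`:

* `exists_hwalk`, `exists_vwalk` — straight plus walks with explicit supports;
* `centre_kept`, `vert_kept`, `slant_kept`, `vert_dropped`, `slant_dropped` — kept / dropped
  vertices in the right leg: the horizontal ports of the two bottom rows and the vertical ports east
  of the wall below height `1` are dropped, everything else used is kept;
* family A: `aA i = centre (n, i+2)`, `bA i = slant n (i+3)`, `vA = centre (2n-3, 3)`; the column is
  a corridor sealed at `aA 0` (`forcingA`), every admissible path from `aA 0` to `vA` visits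
  `aA (n-2) = centre (n, n)` (`forcedA`), and `(aA 0, vA)` is joinable (`joinableA`);
* family B: `aB i = centre (n+1+i, 0)`, `bB i = vert (n+2+i) 0`; the bottom row is an isolated
  corridor (`forcingB`): the admissible path from `aB 0` to `aB (n-4) = centre (2n-3, 0)` is unique
  (`uniqueB`), lies on the bottom side (`im_eq_zero_B`) and exists (`joinableB`).

All [folklore] bookkeeping (linear arithmetic in `nδ`).
-/

noncomputable section

namespace Summit.CriticalPhenomena.SAWScalingLimit.Theorems.SurfaceUniversality.Negative

open Set Metric
open Literature.Probability.RandomPlanarGeometry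
open Literature.Probability.RandomPlanarGeometry.SAW
open Literature.Probability.RandomPlanarGeometry.SAW.YangBaxter

/-! ### Straight plus walks -/

/-- A straight horizontal plus walk along the row `j` from the centre `(k, j)` to the centre
`(k', j)` (`k ≤ k'`), through the east ports; its support consists of the centres `(i, j)`,
`k ≤ i ≤ k'`, and the ports `vert i j`, `k < i ≤ k'`. [folklore] -/
theorem exists_hwalk (j k : ℤ) (m : ℕ) :
    ∃ p : plusLattice.Walk (Sum.inr ((k, j), ()) : PVert) (Sum.inr ((k + m, j), ())),
      ∀ w ∈ p.support, (∃ i : ℤ, k ≤ i ∧ i ≤ k + m ∧ w = Sum.inr ((i, j), ())) ∨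
        (∃ i : ℤ, k < i ∧ i ≤ k + m ∧ w = Sum.inl (.vert i j)) := by
  induction m with
  | zero =>
    rw [Nat.cast_zero, add_zero]
    exact ⟨SimpleGraph.Walk.nil, fun w hw => Or.inl ⟨k, le_rfl, le_rfl, by simpa using hw⟩⟩
  | succ m ih =>
    obtain ⟨p, hp⟩ := ih
    rw [show (k + ((m + 1 : ℕ) : ℤ)) = k + m + 1 by push_cast; ring]
    refine ⟨(p.concat (adj_centre_east (k + m) j)).concat (adj_west_centre (k + m + 1) j),
      fun w hw => ?_⟩
    simp only [SimpleGraph.Walk.support_concat, List.mem_append, List.mem_singleton] at hw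
    rcases hw with (hw | rfl) | rfl
    · rcases hp w hw with ⟨i, h1, h2, rfl⟩ | ⟨i, h1, h2, rfl⟩
      · exact Or.inl ⟨i, h1, by omega, rfl⟩
      · exact Or.inr ⟨i, h1, by omega, rfl⟩
    · exact Or.inr ⟨k + m + 1, by omega, le_rfl, rfl⟩
    · exact Or.inl ⟨k + m + 1, by omega, le_rfl, rfl⟩

/-- A straight vertical plus walk up the column `k` from the centre `(k, j)` to the centre
`(k, j')` (`j ≤ j'`), through the north ports; its support consists of the centres `(k, i)`,
`j ≤ i ≤ j'`, and the ports `slant k i`, `j < i ≤ j'`. [folklore] -/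
theorem exists_vwalk (k j : ℤ) (m : ℕ) :
    ∃ p : plusLattice.Walk (Sum.inr ((k, j), ()) : PVert) (Sum.inr ((k, j + m), ())),
      ∀ w ∈ p.support, (∃ i : ℤ, j ≤ i ∧ i ≤ j + m ∧ w = Sum.inr ((k, i), ())) ∨
        (∃ i : ℤ, j < i ∧ i ≤ j + m ∧ w = Sum.inl (.slant k i)) := by
  induction m with
  | zero =>
    rw [Nat.cast_zero, add_zero]
    exact ⟨SimpleGraph.Walk.nil, fun w hw => Or.inl ⟨j, le_rfl, le_rfl, by simpa using hw⟩⟩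
  | succ m ih =>
    obtain ⟨p, hp⟩ := ih
    rw [show (j + ((m + 1 : ℕ) : ℤ)) = j + m + 1 by push_cast; ring]
    refine ⟨(p.concat (adj_centre_north k (j + m))).concat (adj_south_centre k (j + m + 1)),
      fun w hw => ?_⟩
    simp only [SimpleGraph.Walk.support_concat, List.mem_append, List.mem_singleton] at hw
    rcases hw with (hw | rfl) | rfl
    · rcases hp w hw with ⟨i, h1, h2, rfl⟩ | ⟨i, h1, h2, rfl⟩
      · exact Or.inl ⟨i, h1, by omega, rfl⟩
      · exact Or.inr ⟨i, h1, by omega, rfl⟩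
    · exact Or.inr ⟨j + m + 1, by omega, le_rfl, rfl⟩
    · exact Or.inl ⟨j + m + 1, by omega, le_rfl, rfl⟩

/-! ### The column index `n(δ)` -/

/-- The column index `n(δ) = ⌈1/δ - 1/2⌉₊`: the centres `(n, j)` sit at abscissa
`δ(n + 1/2) ∈ [1, 1 + δ)`. [folklore] -/
def nδ (δ : ℝ) : ℕ := ⌈δ⁻¹ - 1 / 2⌉₊

/-- `1 - δ/2 ≤ n δ < 1 + δ/2` and `n ≥ 8` for `0 < δ ≤ 1/8`. [folklore] -/
theorem nδ_bounds {δ : ℝ} (hδ : 0 < δ) (hδ1 : δ ≤ 1 / 8) :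
    1 - δ / 2 ≤ (nδ δ : ℝ) * δ ∧ (nδ δ : ℝ) * δ < 1 + δ / 2 ∧ 8 ≤ nδ δ := by
  have hinv : (8 : ℝ) ≤ δ⁻¹ := by rw [le_inv_comm₀ (by norm_num) hδ]; linarith
  have h1 : δ⁻¹ - 1 / 2 ≤ (nδ δ : ℝ) := Nat.le_ceil _
  have h2 : (nδ δ : ℝ) < δ⁻¹ - 1 / 2 + 1 := Nat.ceil_lt_add_one (by linarith)
  have e : δ⁻¹ * δ = 1 := inv_mul_cancel₀ hδ.ne'
  refine ⟨?_, ?_, ?_⟩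
  · have := mul_le_mul_of_nonneg_right h1 hδ.le
    rw [sub_mul, e] at this; linarith
  · have := mul_lt_mul_of_pos_right h2 hδ
    rw [add_mul, sub_mul, e] at this; linarith
  · have : (7 : ℝ) < nδ δ := by linarith
    exact_mod_cast this

/-- Multiplying a chain of inequalities by `δ ≥ 0`. [folklore] -/
theorem mul_bounds {δ : ℝ} (hδ : 0 ≤ δ) {a b c : ℝ} (h1 : a ≤ b) (h2 : b ≤ c) :
    a * δ ≤ b * δ ∧ b * δ ≤ c * δ :=
  ⟨mul_le_mul_of_nonneg_right h1 hδ, mul_le_mul_of_nonneg_right h2 hδ⟩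

/-! ### Kept and dropped vertices -/

section Kept

variable {δ : ℝ} (hδ : 0 < δ) (hδ1 : δ ≤ 1 / 8)
include hδ hδ1

/-- Centres `(k, j)` with `n ≤ k ≤ 2n-3`, `0 ≤ j ≤ n+2` are kept (they lie in the closed right leg).
[folklore] -/
theorem centre_kept {k j : ℤ} (hk : (nδ δ : ℤ) ≤ k) (hk' : k ≤ 2 * (nδ δ : ℤ) - 3) (hj : 0 ≤ j)
    (hj' : j ≤ (nδ δ : ℤ) + 2) : (Sum.inr ((k, j), ()) : PVert) ∈ probeSupport rule oct.carrier δ := by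
  obtain ⟨hD1, hD2, hn8⟩ := nδ_bounds hδ hδ1
  have hn8' : (8 : ℝ) ≤ nδ δ := by exact_mod_cast hn8
  obtain ⟨ek1, ek2⟩ := mul_bounds hδ.le (show ((nδ δ : ℕ) : ℝ) ≤ k by exact_mod_cast hk)
    (show (k : ℝ) ≤ 2 * (nδ δ : ℕ) - 3 by exact_mod_cast hk')
  obtain ⟨ej1, ej2⟩ := mul_bounds hδ.le (show (0 : ℝ) ≤ j by exact_mod_cast hj)
    (show (j : ℝ) ≤ (nδ δ : ℕ) + 2 by exact_mod_cast hj')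
  rw [centre_mem_iff, mk_mem_closedArch_iff]
  refine ⟨by linarith, by nlinarith, by linarith, by linarith, Or.inl (by linarith)⟩

/-- Vertical ports `vert k j` with `n+1 ≤ k ≤ 2n-3`, `0 ≤ j ≤ n+2`, and `n+2 ≤ k` or `j = n+2`,
are kept. [folklore] -/
theorem vert_kept {k j : ℤ} (hk : (nδ δ : ℤ) + 1 ≤ k) (hk' : k ≤ 2 * (nδ δ : ℤ) - 3) (hj : 0 ≤ j)
    (hj' : j ≤ (nδ δ : ℤ) + 2) (h3 : (nδ δ : ℤ) + 2 ≤ k ∨ j = (nδ δ : ℤ) + 2) :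
    (Sum.inl (.vert k j) : PVert) ∈ probeSupport rule oct.carrier δ := by
  obtain ⟨hD1, hD2, hn8⟩ := nδ_bounds hδ hδ1
  have hn8' : (8 : ℝ) ≤ nδ δ := by exact_mod_cast hn8
  obtain ⟨ek1, ek2⟩ := mul_bounds hδ.le (show ((nδ δ : ℕ) : ℝ) + 1 ≤ k by exact_mod_cast hk)
    (show (k : ℝ) ≤ 2 * (nδ δ : ℕ) - 3 by exact_mod_cast hk')
  obtain ⟨ej1, ej2⟩ := mul_bounds hδ.le (show (0 : ℝ) ≤ j by exact_mod_cast hj)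
    (show (j : ℝ) ≤ (nδ δ : ℕ) + 2 by exact_mod_cast hj')
  rw [vert_mem_iff, mk_mem_closedArch_iff]
  refine ⟨by linarith, by nlinarith, by linarith, by linarith, ?_⟩
  rcases h3 with h3 | rfl
  · have e3 := mul_le_mul_of_nonneg_right (show ((nδ δ : ℕ) : ℝ) + 2 ≤ k by exact_mod_cast h3) hδ.le
    exact Or.inl (by linarith)
  · push_cast
    exact Or.inr (Or.inr (by linarith))

/-- Horizontal ports `slant k j` with `n ≤ k ≤ 2n-3`, `3 ≤ j ≤ n+2` are kept. [folklore] -/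
theorem slant_kept {k j : ℤ} (hk : (nδ δ : ℤ) ≤ k) (hk' : k ≤ 2 * (nδ δ : ℤ) - 3) (hj : 3 ≤ j)
    (hj' : j ≤ (nδ δ : ℤ) + 2) : (Sum.inl (.slant k j) : PVert) ∈ probeSupport rule oct.carrier δ := by
  obtain ⟨hD1, hD2, hn8⟩ := nδ_bounds hδ hδ1
  have hn8' : (8 : ℝ) ≤ nδ δ := by exact_mod_cast hn8
  obtain ⟨ek1, ek2⟩ := mul_bounds hδ.le (show ((nδ δ : ℕ) : ℝ) ≤ k by exact_mod_cast hk)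
    (show (k : ℝ) ≤ 2 * (nδ δ : ℕ) - 3 by exact_mod_cast hk')
  obtain ⟨ej1, ej2⟩ := mul_bounds hδ.le (show (3 : ℝ) ≤ j by exact_mod_cast hj)
    (show (j : ℝ) ≤ (nδ δ : ℕ) + 2 by exact_mod_cast hj')
  rw [slant_mem_iff, mk_mem_closedArch_iff]
  refine ⟨by linarith, by nlinarith, by linarith, by linarith, Or.inl (by linarith)⟩

/-- The vertical ports just east of the wall `re = 1` below height `1` are DROPPED (their probe
point `3δ/2` to the west falls into the hole `[-1,1] × [0,1)`): the column `(n, ·)` has no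
horizontal links there. [folklore] -/
theorem vert_dropped {k j : ℤ} (hk : k = (nδ δ : ℤ) ∨ k = (nδ δ : ℤ) + 1) (hj : 0 ≤ j)
    (hj' : j + 1 ≤ (nδ δ : ℤ)) : (Sum.inl (.vert k j) : PVert) ∉ probeSupport rule oct.carrier δ := by
  obtain ⟨hD1, hD2, hn8⟩ := nδ_bounds hδ hδ1
  obtain ⟨ej1, ej2⟩ := mul_bounds hδ.le (show (0 : ℝ) ≤ j by exact_mod_cast hj)
    (show (j : ℝ) ≤ (nδ δ : ℕ) - 1 by
      have : (j : ℝ) + 1 ≤ (nδ δ : ℕ) := by exact_mod_cast hj'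
      linarith)
  have hk' : (k : ℝ) = (nδ δ : ℕ) ∨ (k : ℝ) = (nδ δ : ℕ) + 1 := by
    rcases hk with rfl | rfl
    · exact Or.inl (by push_cast; ring)
    · exact Or.inr (by push_cast; ring)
  rw [vert_mem_iff, mk_mem_closedArch_iff]
  rintro ⟨-, -, -, -, h | h | h⟩
  · rcases hk' with e | e <;> rw [e] at h <;> linarith
  · rcases hk' with e | e <;> rw [e] at h <;> nlinarith
  · linarith

/-- The horizontal ports of the two bottom rows are DROPPED (their probe point `2δ` to the south
has negative ordinate): rows `0` and `1` have no vertical links. [folklore] -/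
theorem slant_dropped {k j : ℤ} (hj : j ≤ 2) :
    (Sum.inl (.slant k j) : PVert) ∉ probeSupport rule oct.carrier δ := by
  have ej : (j : ℝ) ≤ 2 := by exact_mod_cast hj
  rw [slant_mem_iff, mk_mem_closedArch_iff]
  rintro ⟨h, -⟩
  nlinarith

end Kept

/-! ### Family A: the sealed column east of the wall `re = 1` -/

/-- The centres of the column: `aA i = centre (n, i + 2)`; `aA 0` is the endpoint `u δ`. [folklore] -/
def aA (δ : ℝ) (i : ℕ) : PVert := Sum.inr ((((nδ δ : ℕ) : ℤ), (i : ℤ) + 2), ())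

/-- The ports of the column: `bA i = slant n (i + 3)` (north port of `aA i`). [folklore] -/
def bA (δ : ℝ) (i : ℕ) : PVert := Sum.inl (.slant ((nδ δ : ℕ) : ℤ) ((i : ℤ) + 3))

/-- The far endpoint `v δ = centre (2n - 3, 3)` of family A (deep in the right leg, near `2`).
[folklore] -/
def vA (δ : ℝ) : PVert := Sum.inr ((((nδ δ : ℕ) : ℤ) + ((nδ δ - 3 : ℕ) : ℤ), 3), ())

section FamilyA

variable {δ : ℝ} (hδ : 0 < δ) (hδ1 : δ ≤ 1 / 8)
include hδ hδ1

/-- **The column is a sealed corridor**: the forcing hypotheses of `forced_chain` for family A with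
`N = n - 2` (the foot `aA 0` has the single kept neighbour `bA 0`; below height `1` the column's
horizontal ports are dropped). [folklore] -/
theorem forcingA :
    (∀ w ∈ probeSupport rule oct.carrier δ, plusLattice.Adj (aA δ 0) w → w = bA δ 0) ∧
    (∀ i, i < nδ δ - 2 → ∀ w, plusLattice.Adj (bA δ i) w → w = aA δ i ∨ w = aA δ (i + 1)) ∧
    (∀ i, i + 1 < nδ δ - 2 → ∀ w ∈ probeSupport rule oct.carrier δ,
      plusLattice.Adj (aA δ (i + 1)) w → w = bA δ i ∨ w = bA δ (i + 1)) ∧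
    (∀ i, i < nδ δ - 2 → aA δ i ≠ vA δ) ∧ (∀ i, i < nδ δ - 2 → bA δ i ≠ vA δ) := by
  obtain ⟨-, -, hn8⟩ := nδ_bounds hδ hδ1
  refine ⟨fun w hw h => ?_, fun i _ w h => ?_, fun i hi w hw h => ?_, fun i _ h => ?_, fun i _ h => ?_⟩
  · rcases adj_centre h with rfl | rfl | rfl | rfl
    · exact absurd hw (vert_dropped hδ hδ1 (Or.inl rfl) (by norm_num) (by omega))
    · exact absurd hw (vert_dropped hδ hδ1 (Or.inr rfl) (by norm_num) (by omega))
    · exact absurd hw (slant_dropped hδ hδ1 (by norm_num))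
    · simp [bA]
  · rcases adj_slant h with rfl | rfl
    · left; simp only [aA]; congr 2; ring_nf
    · right; simp only [aA]; push_cast; ring_nf
  · rcases adj_centre h with rfl | rfl | rfl | rfl
    · exact absurd hw (vert_dropped hδ hδ1 (Or.inl rfl) (by omega) (by push_cast; omega))
    · exact absurd hw (vert_dropped hδ hδ1 (Or.inr rfl) (by omega) (by push_cast; omega))
    · left; simp only [bA]; push_cast; ring_nf
    · right; simp only [bA]; push_cast; ring_nf
  · simp only [aA, vA, Sum.inr.injEq, Prod.mk.injEq] at h
    omega
  · simp [bA, vA] at h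

/-- **Family A is forced through the top of the column**: every self-avoiding plus path from
`aA 0 = centre (n, 2)` to `vA` through the support visits `aA (n-2) = centre (n, n)`, drawn within
`2δ` of the reflex corner `1 + i`. [folklore] -/
theorem forcedA {p : plusLattice.Walk (aA δ 0) (vA δ)} (hp : p.IsPath)
    (hS : ∀ w ∈ p.support, w ∈ probeSupport rule oct.carrier δ) : aA δ (nδ δ - 2) ∈ p.support := by
  obtain ⟨h0, hb, ha, hva, hvb⟩ := forcingA hδ hδ1
  obtain ⟨hl, hg, -⟩ := forced_chain (aA δ) (bA δ) (nδ δ - 2) h0 hb ha hva hvb hp hS _ le_rfl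
  rw [← hg]
  exact p.getVert_mem_support _

/-- **Family A is joinable**: up the column to the row `n + 2` (height `> 1`), east along it, down
the column `2n - 3` to `vA`; all these vertices are kept. [folklore] -/
theorem joinableA : (aA δ 0, vA δ) ∈ plusJoinable (probeSupport rule oct.carrier δ) := by
  classical
  obtain ⟨-, -, hn8⟩ := nδ_bounds hδ hδ1
  set n : ℕ := nδ δ with hn
  have e0 : (Sum.inr (((n : ℤ), (2 : ℤ)), ()) : PVert) = aA δ 0 := by simp [aA, hn]
  obtain ⟨p1, hp1⟩ : ∃ p : plusLattice.Walk (aA δ 0) (Sum.inr (((n : ℤ), 2 + (n : ℤ)), ())),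
      ∀ w ∈ p.support, (∃ i : ℤ, 2 ≤ i ∧ i ≤ 2 + n ∧ w = Sum.inr (((n : ℤ), i), ())) ∨
        (∃ i : ℤ, 2 < i ∧ i ≤ 2 + n ∧ w = Sum.inl (.slant n i)) := by
    have := exists_vwalk (n : ℤ) 2 n; rwa [e0] at this
  obtain ⟨p2, hp2⟩ := exists_hwalk (2 + (n : ℤ)) n (n - 3)
  obtain ⟨p3, hp3⟩ : ∃ p : plusLattice.Walk (Sum.inr ((((n : ℤ) + ((n - 3 : ℕ) : ℤ)), 3), ()))
      (Sum.inr ((((n : ℤ) + ((n - 3 : ℕ) : ℤ)), 2 + (n : ℤ)), ())),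
      ∀ w ∈ p.support, (∃ i : ℤ, 3 ≤ i ∧ i ≤ 2 + n ∧ w = Sum.inr ((((n : ℤ) + ((n - 3 : ℕ) : ℤ)), i), ())) ∨
        (∃ i : ℤ, 3 < i ∧ i ≤ 2 + n ∧ w = Sum.inl (.slant ((n : ℤ) + ((n - 3 : ℕ) : ℤ)) i)) := by
    have := exists_vwalk ((n : ℤ) + ((n - 3 : ℕ) : ℤ)) 3 (n - 1)
    rwa [show (3 : ℤ) + ((n - 1 : ℕ) : ℤ) = 2 + n by omega] at this
  let W := p1.append (p2.append p3.reverse)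
  refine ⟨W.bypass, W.bypass_isPath, fun w hw => ?_⟩
  have hw' := W.support_bypass_subset_support hw
  simp only [W, SimpleGraph.Walk.mem_support_append_iff, SimpleGraph.Walk.support_reverse,
    List.mem_reverse] at hw'
  have hk3 : (n : ℤ) + ((n - 3 : ℕ) : ℤ) ≤ 2 * (nδ δ : ℤ) - 3 := by rw [← hn]; omega
  have hk3' : (nδ δ : ℤ) ≤ (n : ℤ) + ((n - 3 : ℕ) : ℤ) := by rw [← hn]; omega
  rcases hw' with hw' | hw' | hw'
  · rcases hp1 w hw' with ⟨i, h1, h2, rfl⟩ | ⟨i, h1, h2, rfl⟩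
    · exact centre_kept hδ hδ1 le_rfl (by omega) (by omega) (by omega)
    · exact slant_kept hδ hδ1 le_rfl (by omega) (by omega) (by omega)
  · rcases hp2 w hw' with ⟨i, h1, h2, rfl⟩ | ⟨i, h1, h2, rfl⟩
    · exact centre_kept hδ hδ1 h1 (by omega) (by omega) (by omega)
    · exact vert_kept hδ hδ1 (by omega) (by omega) (by omega) (by omega) (Or.inr (by omega))
  · rcases hp3 w hw' with ⟨i, h1, h2, rfl⟩ | ⟨i, h1, h2, rfl⟩
    · exact centre_kept hδ hδ1 hk3' hk3 (by omega) (by omega)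
    · exact slant_kept hδ hδ1 hk3' hk3 (by omega) (by omega)

end FamilyA

/-! ### Family B: the isolated bottom row -/

/-- The centres of the bottom corridor: `aB i = centre (n + 1 + i, 0)`; `aB 0` is the endpoint
`u' δ` and `aB (n - 4) = centre (2n - 3, 0)` the endpoint `v' δ`. [folklore] -/
def aB (δ : ℝ) (i : ℕ) : PVert := Sum.inr ((((nδ δ : ℕ) : ℤ) + 1 + (i : ℤ), 0), ())

/-- The ports of the bottom corridor: `bB i = vert (n + 2 + i) 0` (east port of `aB i`). [folklore] -/
def bB (δ : ℝ) (i : ℕ) : PVert := Sum.inl (.vert (((nδ δ : ℕ) : ℤ) + 2 + (i : ℤ)) 0)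

section FamilyB

variable {δ : ℝ} (hδ : 0 < δ) (hδ1 : δ ≤ 1 / 8)
include hδ hδ1

/-- **The bottom row is an isolated corridor sealed at `aB 0`**: the forcing hypotheses of
`forced_chain` for family B with `N = n - 4` (rows `0, 1` have no vertical links, the west port of
`aB 0` is dropped). [folklore] -/
theorem forcingB :
    (∀ w ∈ probeSupport rule oct.carrier δ, plusLattice.Adj (aB δ 0) w → w = bB δ 0) ∧
    (∀ i, i < nδ δ - 4 → ∀ w, plusLattice.Adj (bB δ i) w → w = aB δ i ∨ w = aB δ (i + 1)) ∧
    (∀ i, i + 1 < nδ δ - 4 → ∀ w ∈ probeSupport rule oct.carrier δ,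
      plusLattice.Adj (aB δ (i + 1)) w → w = bB δ i ∨ w = bB δ (i + 1)) ∧
    (∀ i, i < nδ δ - 4 → aB δ i ≠ aB δ (nδ δ - 4)) ∧ (∀ i, i < nδ δ - 4 → bB δ i ≠ aB δ (nδ δ - 4)) := by
  obtain ⟨-, -, hn8⟩ := nδ_bounds hδ hδ1
  refine ⟨fun w hw h => ?_, fun i _ w h => ?_, fun i hi w hw h => ?_, fun i hi h => ?_, fun i _ h => ?_⟩
  · simp only [aB, Nat.cast_zero, add_zero] at h
    rcases adj_centre h with rfl | rfl | rfl | rfl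
    · exact absurd hw (vert_dropped hδ hδ1 (Or.inr rfl) le_rfl (by omega))
    · simp only [bB]; push_cast; ring_nf
    · exact absurd hw (slant_dropped hδ hδ1 (by norm_num))
    · exact absurd hw (slant_dropped hδ hδ1 (by norm_num))
  · rcases adj_vert h with rfl | rfl
    · left; simp only [aB]; congr 3; ring
    · right; simp only [aB]; push_cast; ring_nf
  · rcases adj_centre h with rfl | rfl | rfl | rfl
    · left; simp only [bB]; push_cast; ring_nf
    · right; simp only [bB]; push_cast; ring_nf
    · exact absurd hw (slant_dropped hδ hδ1 (by norm_num))
    · exact absurd hw (slant_dropped hδ hδ1 (by norm_num))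
  · simp only [aB, Sum.inr.injEq, Prod.mk.injEq] at h
    omega
  · simp [aB, bB] at h

/-- **The bottom corridor path is unique.** [folklore] -/
theorem uniqueB {p q : plusLattice.Walk (aB δ 0) (aB δ (nδ δ - 4))} (hp : p.IsPath)
    (hpS : ∀ w ∈ p.support, w ∈ probeSupport rule oct.carrier δ) (hq : q.IsPath)
    (hqS : ∀ w ∈ q.support, w ∈ probeSupport rule oct.carrier δ) : p = q := by
  obtain ⟨h0, hb, ha, hva, hvb⟩ := forcingB hδ hδ1
  exact forced_chain_unique (aB δ) (bB δ) (nδ δ - 4) h0 hb ha hva hvb hp hpS hq hqS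

/-- **The bottom corridor path stays on the bottom side**: every drawn vertex has ordinate `0`.
[folklore] -/
theorem im_eq_zero_B {p : plusLattice.Walk (aB δ 0) (aB δ (nδ δ - 4))} (hp : p.IsPath)
    (hS : ∀ w ∈ p.support, w ∈ probeSupport rule oct.carrier δ) :
    ∀ w ∈ p.support, ((δ : ℂ) * PortGadget.embed plusPos w).im = 0 := by
  obtain ⟨h0, hb, ha, hva, hvb⟩ := forcingB hδ hδ1
  have H := forced_chain (aB δ) (bB δ) (nδ δ - 4) h0 hb ha hva hvb hp hS
  have hlen : p.length = 2 * (nδ δ - 4) := by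
    obtain ⟨hl, hg, -⟩ := H _ le_rfl
    exact hp.getVert_injOn (show p.length ∈ {i | i ≤ p.length} by simp) hl
      (p.getVert_length.trans hg.symm)
  intro w hw
  obtain ⟨k, rfl, hk⟩ := SimpleGraph.Walk.mem_support_iff_exists_getVert.1 hw
  rw [hlen] at hk
  obtain ⟨i, rfl | rfl⟩ := Nat.even_or_odd' k
  · rw [(H i (by omega)).2.1, aB, (draw_centre δ _ _)]; simp
  · rw [((H i (by omega)).2.2 (by omega)).2, bB, draw_vert_im]; simp

/-- **Family B is joinable** (along the bottom row). [folklore] -/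
theorem joinableB : (aB δ 0, aB δ (nδ δ - 4)) ∈ plusJoinable (probeSupport rule oct.carrier δ) := by
  classical
  obtain ⟨-, -, hn8⟩ := nδ_bounds hδ hδ1
  set n : ℕ := nδ δ with hn
  have e0 : (Sum.inr ((((n : ℤ) + 1), (0 : ℤ)), ()) : PVert) = aB δ 0 := by simp [aB, hn]
  obtain ⟨p, hp⟩ : ∃ p : plusLattice.Walk (aB δ 0) (aB δ (n - 4)),
      ∀ w ∈ p.support, (∃ i : ℤ, (n : ℤ) + 1 ≤ i ∧ i ≤ (n : ℤ) + 1 + ((n - 4 : ℕ) : ℤ) ∧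
        w = Sum.inr ((i, 0), ())) ∨ (∃ i : ℤ, (n : ℤ) + 1 < i ∧ i ≤ (n : ℤ) + 1 + ((n - 4 : ℕ) : ℤ) ∧
          w = Sum.inl (.vert i 0)) := by
    have := exists_hwalk 0 ((n : ℤ) + 1) (n - 4); rwa [e0] at this
  refine ⟨p.bypass, p.bypass_isPath, fun w hw => ?_⟩
  rcases hp w (p.support_bypass_subset_support hw) with ⟨i, h1, h2, rfl⟩ | ⟨i, h1, h2, rfl⟩
  · exact centre_kept hδ hδ1 (by omega) (by omega) le_rfl (by omega)
  · exact vert_kept hδ hδ1 (by omega) (by omega) le_rfl (by omega) (Or.inl (by omega))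

end FamilyB

end Summit.CriticalPhenomena.SAWScalingLimit.Theorems.SurfaceUniversality.Negative

end
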